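import Summits.CriticalPhenomena.PercolationContinuityZ3.Theses.PercLoopDislocationCovers

/-!
# Birth skeleton (BC3) for the crux `CoverSlopeBound` of route `PercLoopDislocationCovers`

Crux (rank 2) — LIVE route decl
`Summit.CriticalPhenomena.PercolationContinuityZ3.Theses.PercLoopDislocationCovers.CoverSlopeBound`
(live item `stmt-CriticalPhenomena-13951`; this workfile is filed on crux item
`stmt-CriticalPhenomena-6528`, whose own ledger decl is the rev-0 inlined-`fromRel` text kept in the
CLOSED (superseded) route file `Theses/PercDislocationCovers.lean` and which was `replaced`
6528 → 13890 → 13912 → 13951 in the live route; both item ids share this crux directory, and the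
skeleton is registered with `--crux-decl` = the live decl, which `CoverSlopeBound_of` /
`CoverSlopeBound_of_stubs` conclude BY NAME):
there is `C` such that for every spacing `s ≥ 2` and every `p ≤ p_c(ℤ³)`

  `θ_{G_s}(õ, p) ≤ C · s^{5/6} · max 0 (p − p_c(G_s, õ))`,

`G_s = Literature.Probability.Percolation.dislocationLoopCover s` the loop-dislocated `ℤ/2`-cover of
`ℤ³`, `õ = (0, [])` its root.

## The cut (four named stubs, none a restatement of the crux or of `θ(p_c) = 0`)

Write `Δ_s := p_c(ℤ³) − p_c(G_s, õ)` (the threshold shift of the cover) and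
`π_p(n) := P_p^{ℤ³}(0 ↔ ∂B(n))` (the one-arm probability of the BASE lattice, event
`siteToBoundary 3 n`). The crux is SIZE × SHAPE:

* `stub_coverCriticalDies` — AT the cover's own critical point there is no percolation:
  `θ_{G_s}(õ, p_c(G_s, õ)) = 0` (Hutchcroft 2016 for the quasi-transitive, exponential-growth root
  component `ℤ³ × W` of `G_s`; ingredients `deck`, `shift`, `reachable_root_iff`). Size L.
* `stub_flatBall` — LOCALITY: the ball of radius `< ⌈s/2⌉` about `õ` is a copy of the `ℤ³`-ball
  (no patch bond inside `box 3 ⌊s/4⌋`), so percolation from `õ` forces a flat open arm: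
  `θ_{G_s}(õ, p) ≤ π_p(⌊s/4⌋)` for every `p`. Provable now (pushforward of the product measure
  along the sheet `[]`). Size M.
* `stub_shiftLowerBound` — SIZE AT THE BINDING POINT `p = p_c(ℤ³)`: the cover's threshold sits
  strictly and QUANTITATIVELY below `p_c(ℤ³)`:
  `p_c(G_s, õ) < p_c(ℤ³)` and `π_{p_c}(⌊s/4⌋) ≤ C · s^a · Δ_s` for some `a < 5/6`
  (a quantitative Martineau–Severo strict inequality at the dislocation scale; scaling predicts
  `Δ_s ≈ s^{-1/ν} ≈ s^{-1.14}` against the required `≥ s^{-a-β/ν}`, i.e. `a ≥ (1−β)/ν ≈ 0.66`,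
  margin `0.17` — the crux's own margin). This is the route's "Newman-type slope" half. Open.
* `stub_windowShape` — SHAPE ACROSS THE WINDOW `(p_c(G_s), p_c(ℤ³)]`: the cover's `θ` overshoots
  the chord from `(p_c(G_s), 0)` to `(p_c(ℤ³), θ_{G_s}(õ, p_c(ℤ³)))` by at most a subpolynomial
  factor: for every `η > 0`, `θ_{G_s}(õ,p) · Δ_s ≤ C_η s^η · θ_{G_s}(õ, p_c(ℤ³)) · (p − p_c(G_s))`.
  Galton–Watson-over-lifted-cores picture: `θ_{G_s}(õ,p) ≈ π_p(s/2) · ρ_s(p)` with both factors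
  increasing and `π_p(s/2)` still `e^{-Θ(s/ξ(p))}`-suppressed where the survival probability `ρ_s`
  saturates, so the predicted overshoot is `O(1)` (at worst `log s`). This is the route's
  "free-product mean-field" half. Open.

`CoverSlopeBound_of` assembles them by real arithmetic: below `p_c(G_s)` the bound is `0 ≤ 0`
(`theta_eq_zero_of_lt_criticalProb_holds`), at `p_c(G_s)` it is `stub_coverCriticalDies`, and on
the window `θ · Δ_s ≤ C_η s^η θ(p_c) (p − p_c(G_s)) ≤ C_η s^η · π_{p_c}(⌊s/4⌋) · (p − p_c(G_s))
≤ C_η C s^{η+a} Δ_s (p − p_c(G_s))` with `η := 5/6 − a`, then divide by `Δ_s > 0`.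

Disproof used: none exists for this crux (`ledger crux ls stmt-CriticalPhenomena-6528`: no
workfiles; no `Theorems/CoverSlopeBound/Negative/`). Negatives index: nothing on covers.
Sources: Hutchcroft2016, arXiv:1904.05804, arXiv:2002.02916, MartineauSevero2019
(arXiv:1803.09686), LyonsPeres2016 Thm 6.47, BenjaminiSchramm1996, arXiv:math/0611668,
arXiv:0801.4153, zbl:0948.60098 (HPS merging), Grimmett1999.
-/

namespace Summit.CriticalPhenomena.PercolationContinuityZ3.Cruxes.CoverSlopeBound.Birth

open Literature.Probability.Percolation Literature.Probability.LatticeModels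

/-- **Stub S0 (cover critical point dies; Hutchcroft 2016 instance, size L).** For every spacing
`s ≥ 2` the loop-dislocated cover does not percolate from its root AT its own critical point:
`θ_{G_s}(õ, p_c(G_s, õ)) = 0`. The root component of `G_s` is `ℤ³ × W` (`reachable_root_iff`),
quasi-transitive (deck transformations `deck`, lifted translations `shift`, `≤ s³` orbits) and of
exponential growth (`W = ∗ ℤ/2` over the patch labels, patches exist by `isPatchBase_corner`), so
Hutchcroft's theorem "critical percolation on a quasi-transitive graph of exponential growth has
no infinite cluster" applies. Stated with a `unitInterval` parameter equal to the (real) critical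
value. [sources: Hutchcroft2016; LyonsPeres2016 §7; Biggs1974 Def 19.1] -/
theorem stub_coverCriticalDies :
    ∀ s : ℕ, 2 ≤ s → ∀ p : unitInterval,
      (p : ℝ) = Literature.Probability.Percolation.criticalProb
        (Literature.Probability.Percolation.dislocationLoopCover s)
        ((0 : Literature.Probability.LatticeModels.Site 3), ([] : List (ℤ × ℤ × ℤ))) →
      Literature.Probability.Percolation.theta
        (Literature.Probability.Percolation.dislocationLoopCover s)
        ((0 : Literature.Probability.LatticeModels.Site 3), ([] : List (ℤ × ℤ × ℤ))) p = 0 := by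
  sorry

/-- **Stub S1 (flat ball / locality, provable now, size M).** The box `box 3 ⌊s/4⌋` contains no
dislocation-patch bond (patch bonds have an endpoint with `|y| ≥ ⌈s/2⌉ - 1 ≥ ⌊s/4⌋`... more
precisely both endpoints inside the box would need `|u 1| ≤ ⌊s/4⌋` with `u 1 ≡ ⌊s/2⌋ (mod s)`),
so every `G_s`-path from `õ = (0, [])` keeps the word `[]` until its projection leaves the box;
an infinite open cluster at `õ` therefore contains a flat open arm from `0` to the inner boundary
of the box inside the sheet `[]`, whose law is the `ℤ³` bond measure (pushforward of the product
measure under the bijection of edge sets). Hence `θ_{G_s}(õ, p) ≤ π_p(⌊s/4⌋) = P_p(0 ↔ ∂B(⌊s/4⌋))`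
for every `p` (for `s ≤ 3` the right-hand side is `1`).
[sources: LyonsPeres2016 §6.9; Grimmett1999 §1.4; Literature `dislocationLoopCover_adj_of_bondLetter_eq_none`] -/
theorem stub_flatBall :
    ∀ s : ℕ, 2 ≤ s → ∀ p : unitInterval,
      Literature.Probability.Percolation.theta
          (Literature.Probability.Percolation.dislocationLoopCover s)
          ((0 : Literature.Probability.LatticeModels.Site 3), ([] : List (ℤ × ℤ × ℤ))) p ≤
        (Literature.Probability.Percolation.bondPercolation
            (Literature.Probability.LatticeModels.zdGraph 3) p).real
          (Literature.Probability.Percolation.siteToBoundary 3 (s / 4)) := by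
  sorry

/-- **Stub S2 (quantitative threshold shift at the binding point; the "Newman-type slope" half,
open, size L/open-problem).** There are `a < 5/6` and `C` such that for every `s ≥ 2` the cover's
threshold lies strictly below the base threshold, `p_c(G_s, õ) < p_c(ℤ³)` (Martineau–Severo strict
monotonicity under the non-trivial quasi-transitive covering `Prod.fst : G_s → ℤ³`; includes
`p_c(ℤ³) > 0`), and quantitatively the shift dominates the base one-arm probability at the
dislocation scale: `π_{p_c(ℤ³)}(⌊s/4⌋) ≤ C · s^a · (p_c(ℤ³) − p_c(G_s, õ))`. Scaling prediction:
`π_{p_c}(s/4) ≈ s^{-β/ν} ≈ s^{-0.48}`, shift `≈ (log s / s)^{1/ν} ≈ s^{-1.14}`, so any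
`a ≥ (1-β)/ν ≈ 0.66` works; the stub asks `a < 5/6 ≈ 0.83` (margin 0.17, the crux's margin).
Why it might fail: it is a polynomial LOWER bound on a threshold shift — Martineau–Severo's proof
gives only an exponentially small one, and showing that `G_s` percolates at `p_c(ℤ³) − s^{-a}π/C`
needs near-critical patch-to-patch gluing in `ℤ³` at scale `s ≲ ξ(p)`.
[sources: MartineauSevero2019 = arXiv:1803.09686 Thm 2.1/Cor 2.3; arXiv:math/0611668; arXiv:0801.4153; Newman1986; Grimmett1999 §1.4] -/
theorem stub_shiftLowerBound :
    ∃ a C : ℝ, a < 5 / 6 ∧ ∀ s : ℕ, 2 ≤ s →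
      Literature.Probability.Percolation.criticalProb
            (Literature.Probability.Percolation.dislocationLoopCover s)
            ((0 : Literature.Probability.LatticeModels.Site 3), ([] : List (ℤ × ℤ × ℤ))) <
          Literature.Probability.Percolation.criticalProb
            (Literature.Probability.LatticeModels.zdGraph 3) 0 ∧
        (Literature.Probability.Percolation.bondPercolation
              (Literature.Probability.LatticeModels.zdGraph 3)
              (Literature.Probability.Percolation.criticalProbI 3)).real
            (Literature.Probability.Percolation.siteToBoundary 3 (s / 4)) ≤
          C * (s : ℝ) ^ a *
            (Literature.Probability.Percolation.criticalProb
                (Literature.Probability.LatticeModels.zdGraph 3) 0 -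
              Literature.Probability.Percolation.criticalProb
                (Literature.Probability.Percolation.dislocationLoopCover s)
                ((0 : Literature.Probability.LatticeModels.Site 3), ([] : List (ℤ × ℤ × ℤ)))) := by
  sorry

/-- **Stub S3 (window shape: subpolynomial overshoot over the chord; the "free-product
mean-field" half, open, size L).** For every `η > 0` there is `C_η` such that for all `s ≥ 2` and
all `p` in the cover's window `p_c(G_s, õ) < p ≤ p_c(ℤ³)`:
`θ_{G_s}(õ, p) · (p_c(ℤ³) − p_c(G_s, õ)) ≤ C_η · s^η · θ_{G_s}(õ, p_c(ℤ³)) · (p − p_c(G_s, õ))`,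
i.e. normalised by its endpoint value and the window length, `θ_{G_s}(õ, ·)` rises across its
window at most `C_η s^η` times faster than the chord. Mechanism: the cluster of `õ` is a
Galton–Watson process over the tree of lifted patch cores (Bass–Serre tree of `W = ∗ ℤ/2`;
Kozáková, Špakulová), `θ ≈ π_p(s/2) · ρ_s(p)` with `π_p(s/2)` still `exp(-Θ(s/ξ(p)))`-small where
the survival probability `ρ_s` saturates — predicted overshoot `O(1)`, at worst `log s ≪ s^η`;
needs Russo control of the offspring mean and left-continuity of `θ_{G_s}` on the window
(Häggström–Peres–Schonmann merging on the quasi-transitive cover). Why it might fail: a survival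
probability saturating within `o(s^{-η}Δ_s)` of `p_c(G_s)` while the arm factor is already of
order `π_{p_c}(s)`, or heavy-tailed core offspring, would give polynomial overshoot.
[sources: arXiv:math/0611668; arXiv:0801.4153; arXiv:2002.02916; arXiv:1904.05804; zbl:0948.60098; LyonsPeres2016 §5] -/
theorem stub_windowShape :
    ∀ η : ℝ, 0 < η → ∃ C : ℝ, ∀ s : ℕ, 2 ≤ s → ∀ p : unitInterval,
      Literature.Probability.Percolation.criticalProb
            (Literature.Probability.Percolation.dislocationLoopCover s)
            ((0 : Literature.Probability.LatticeModels.Site 3), ([] : List (ℤ × ℤ × ℤ))) < (p : ℝ) →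
        (p : ℝ) ≤ Literature.Probability.Percolation.criticalProb
            (Literature.Probability.LatticeModels.zdGraph 3) 0 →
          Literature.Probability.Percolation.theta
                (Literature.Probability.Percolation.dislocationLoopCover s)
                ((0 : Literature.Probability.LatticeModels.Site 3), ([] : List (ℤ × ℤ × ℤ))) p *
              (Literature.Probability.Percolation.criticalProb
                  (Literature.Probability.LatticeModels.zdGraph 3) 0 -
                Literature.Probability.Percolation.criticalProb
                  (Literature.Probability.Percolation.dislocationLoopCover s)
                  ((0 : Literature.Probability.LatticeModels.Site 3), ([] : List (ℤ × ℤ × ℤ)))) ≤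
            C * (s : ℝ) ^ η *
                Literature.Probability.Percolation.theta
                  (Literature.Probability.Percolation.dislocationLoopCover s)
                  ((0 : Literature.Probability.LatticeModels.Site 3), ([] : List (ℤ × ℤ × ℤ)))
                  (Literature.Probability.Percolation.criticalProbI 3) *
              ((p : ℝ) -
                Literature.Probability.Percolation.criticalProb
                  (Literature.Probability.Percolation.dislocationLoopCover s)
                  ((0 : Literature.Probability.LatticeModels.Site 3), ([] : List (ℤ × ℤ × ℤ)))) := by
  sorry

/-- **The real-analysis core of the assembly** (no percolation content): abstract
`Θ s p = θ_{G_s}(õ,p)`, `Pc s = p_c(G_s,õ)`, `A p n = π_p(n)`, `pcI = p_c(ℤ³)`. [folklore] -/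
theorem slope_of_size_and_shape (Θ : ℕ → unitInterval → ℝ) (Pc : ℕ → ℝ)
    (A : unitInterval → ℕ → ℝ) (pcI : unitInterval)
    (hΘ : ∀ s p, 0 ≤ Θ s p)
    (hlt : ∀ (s : ℕ) (p : unitInterval), (p : ℝ) < Pc s → Θ s p = 0)
    (h0 : ∀ s : ℕ, 2 ≤ s → ∀ p : unitInterval, (p : ℝ) = Pc s → Θ s p = 0)
    (h1 : ∀ s : ℕ, 2 ≤ s → ∀ p : unitInterval, Θ s p ≤ A p (s / 4))
    (h2 : ∃ a C : ℝ, a < 5 / 6 ∧ ∀ s : ℕ, 2 ≤ s →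
      Pc s < (pcI : ℝ) ∧ A pcI (s / 4) ≤ C * (s : ℝ) ^ a * ((pcI : ℝ) - Pc s))
    (h3 : ∀ η : ℝ, 0 < η → ∃ C : ℝ, ∀ s : ℕ, 2 ≤ s → ∀ p : unitInterval,
      Pc s < (p : ℝ) → (p : ℝ) ≤ pcI →
        Θ s p * ((pcI : ℝ) - Pc s) ≤ C * (s : ℝ) ^ η * Θ s pcI * ((p : ℝ) - Pc s)) :
    ∃ C : ℝ, ∀ s : ℕ, 2 ≤ s → ∀ p : unitInterval, (p : ℝ) ≤ pcI →
      Θ s p ≤ C * (s : ℝ) ^ ((5 : ℝ) / 6) * max 0 ((p : ℝ) - Pc s) := by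
  obtain ⟨a, C₂, ha, h2'⟩ := h2
  obtain ⟨C₃, h3'⟩ := h3 ((5 : ℝ) / 6 - a) (by linarith)
  refine ⟨max C₃ 1 * C₂, fun s hs p hp => ?_⟩
  obtain ⟨hΔ, hA⟩ := h2' s hs
  have hΔpos : 0 < (pcI : ℝ) - Pc s := sub_pos.2 hΔ
  rcases lt_trichotomy (p : ℝ) (Pc s) with hbelow | hat | habove
  · rw [hlt s p hbelow, max_eq_left (by linarith : (p : ℝ) - Pc s ≤ 0), mul_zero]
  · rw [h0 s hs p hat, max_eq_left (by linarith : (p : ℝ) - Pc s ≤ 0), mul_zero]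
  · have hδ : 0 < (p : ℝ) - Pc s := sub_pos.2 habove
    rw [max_eq_right hδ.le]
    have hs0 : (0 : ℝ) < s := by exact_mod_cast (by omega : 0 < s)
    have hC₃' : (0 : ℝ) ≤ max C₃ 1 := le_trans zero_le_one (le_max_right _ _)
    have hX : 0 ≤ (s : ℝ) ^ ((5 : ℝ) / 6 - a) * Θ s pcI * ((p : ℝ) - Pc s) :=
      mul_nonneg (mul_nonneg (Real.rpow_nonneg hs0.le _) (hΘ s pcI)) hδ.le
    have hΘpcI : Θ s pcI ≤ C₂ * (s : ℝ) ^ a * ((pcI : ℝ) - Pc s) := le_trans (h1 s hs pcI) hA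
    have hpow : (s : ℝ) ^ ((5 : ℝ) / 6 - a) * (s : ℝ) ^ a = (s : ℝ) ^ ((5 : ℝ) / 6) := by
      rw [← Real.rpow_add hs0, sub_add_cancel]
    have key : Θ s p * ((pcI : ℝ) - Pc s) ≤
        (max C₃ 1 * C₂ * (s : ℝ) ^ ((5 : ℝ) / 6) * ((p : ℝ) - Pc s)) * ((pcI : ℝ) - Pc s) :=
      calc Θ s p * ((pcI : ℝ) - Pc s)
            ≤ C₃ * (s : ℝ) ^ ((5 : ℝ) / 6 - a) * Θ s pcI * ((p : ℝ) - Pc s) := h3' s hs p habove hp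
        _ = C₃ * ((s : ℝ) ^ ((5 : ℝ) / 6 - a) * Θ s pcI * ((p : ℝ) - Pc s)) := by ring
        _ ≤ max C₃ 1 * ((s : ℝ) ^ ((5 : ℝ) / 6 - a) * Θ s pcI * ((p : ℝ) - Pc s)) :=
            mul_le_mul_of_nonneg_right (le_max_left _ _) hX
        _ ≤ max C₃ 1 * ((s : ℝ) ^ ((5 : ℝ) / 6 - a) * (C₂ * (s : ℝ) ^ a * ((pcI : ℝ) - Pc s)) *
              ((p : ℝ) - Pc s)) := by
            apply mul_le_mul_of_nonneg_left _ hC₃'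
            apply mul_le_mul_of_nonneg_right _ hδ.le
            exact mul_le_mul_of_nonneg_left hΘpcI (Real.rpow_nonneg hs0.le _)
        _ = (max C₃ 1 * C₂ * ((s : ℝ) ^ ((5 : ℝ) / 6 - a) * (s : ℝ) ^ a) * ((p : ℝ) - Pc s)) *
              ((pcI : ℝ) - Pc s) := by ring
        _ = (max C₃ 1 * C₂ * (s : ℝ) ^ ((5 : ℝ) / 6) * ((p : ℝ) - Pc s)) * ((pcI : ℝ) - Pc s) := by
            rw [hpow]
    exact le_of_mul_le_mul_right key hΔpos

/-- **Assembly (kernel-checked, no `sorry`): the four stubs imply the crux BY NAME.**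
`CoverSlopeBound` for route `PercLoopDislocationCovers` from S0 (critical point of the cover dies),
S1 (flat-ball locality), S2 (quantitative threshold shift, exponent `a < 5/6`) and S3 (window
shape, every `η > 0`, used at `η = 5/6 − a`); below `p_c(G_s)` by
`theta_eq_zero_of_lt_criticalProb_holds`. [folklore] -/
theorem CoverSlopeBound_of :
    (∀ s : ℕ, 2 ≤ s → ∀ p : unitInterval,
      (p : ℝ) = Literature.Probability.Percolation.criticalProb
        (Literature.Probability.Percolation.dislocationLoopCover s)
        ((0 : Literature.Probability.LatticeModels.Site 3), ([] : List (ℤ × ℤ × ℤ))) →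
      Literature.Probability.Percolation.theta
        (Literature.Probability.Percolation.dislocationLoopCover s)
        ((0 : Literature.Probability.LatticeModels.Site 3), ([] : List (ℤ × ℤ × ℤ))) p = 0) →
    (∀ s : ℕ, 2 ≤ s → ∀ p : unitInterval,
      Literature.Probability.Percolation.theta
          (Literature.Probability.Percolation.dislocationLoopCover s)
          ((0 : Literature.Probability.LatticeModels.Site 3), ([] : List (ℤ × ℤ × ℤ))) p ≤
        (Literature.Probability.Percolation.bondPercolation
            (Literature.Probability.LatticeModels.zdGraph 3) p).real
          (Literature.Probability.Percolation.siteToBoundary 3 (s / 4))) →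
    (∃ a C : ℝ, a < 5 / 6 ∧ ∀ s : ℕ, 2 ≤ s →
      Literature.Probability.Percolation.criticalProb
            (Literature.Probability.Percolation.dislocationLoopCover s)
            ((0 : Literature.Probability.LatticeModels.Site 3), ([] : List (ℤ × ℤ × ℤ))) <
          Literature.Probability.Percolation.criticalProb
            (Literature.Probability.LatticeModels.zdGraph 3) 0 ∧
        (Literature.Probability.Percolation.bondPercolation
              (Literature.Probability.LatticeModels.zdGraph 3)
              (Literature.Probability.Percolation.criticalProbI 3)).real
            (Literature.Probability.Percolation.siteToBoundary 3 (s / 4)) ≤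
          C * (s : ℝ) ^ a *
            (Literature.Probability.Percolation.criticalProb
                (Literature.Probability.LatticeModels.zdGraph 3) 0 -
              Literature.Probability.Percolation.criticalProb
                (Literature.Probability.Percolation.dislocationLoopCover s)
                ((0 : Literature.Probability.LatticeModels.Site 3), ([] : List (ℤ × ℤ × ℤ))))) →
    (∀ η : ℝ, 0 < η → ∃ C : ℝ, ∀ s : ℕ, 2 ≤ s → ∀ p : unitInterval,
      Literature.Probability.Percolation.criticalProb
            (Literature.Probability.Percolation.dislocationLoopCover s)
            ((0 : Literature.Probability.LatticeModels.Site 3), ([] : List (ℤ × ℤ × ℤ))) < (p : ℝ) →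
        (p : ℝ) ≤ Literature.Probability.Percolation.criticalProb
            (Literature.Probability.LatticeModels.zdGraph 3) 0 →
          Literature.Probability.Percolation.theta
                (Literature.Probability.Percolation.dislocationLoopCover s)
                ((0 : Literature.Probability.LatticeModels.Site 3), ([] : List (ℤ × ℤ × ℤ))) p *
              (Literature.Probability.Percolation.criticalProb
                  (Literature.Probability.LatticeModels.zdGraph 3) 0 -
                Literature.Probability.Percolation.criticalProb
                  (Literature.Probability.Percolation.dislocationLoopCover s)
                  ((0 : Literature.Probability.LatticeModels.Site 3), ([] : List (ℤ × ℤ × ℤ)))) ≤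
            C * (s : ℝ) ^ η *
                Literature.Probability.Percolation.theta
                  (Literature.Probability.Percolation.dislocationLoopCover s)
                  ((0 : Literature.Probability.LatticeModels.Site 3), ([] : List (ℤ × ℤ × ℤ)))
                  (Literature.Probability.Percolation.criticalProbI 3) *
              ((p : ℝ) -
                Literature.Probability.Percolation.criticalProb
                  (Literature.Probability.Percolation.dislocationLoopCover s)
                  ((0 : Literature.Probability.LatticeModels.Site 3), ([] : List (ℤ × ℤ × ℤ))))) →
    Summit.CriticalPhenomena.PercolationContinuityZ3.Theses.PercLoopDislocationCovers.CoverSlopeBound := by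
  intro h0 h1 h2 h3
  exact slope_of_size_and_shape
    (fun s p => Literature.Probability.Percolation.theta
      (Literature.Probability.Percolation.dislocationLoopCover s)
      ((0 : Literature.Probability.LatticeModels.Site 3), ([] : List (ℤ × ℤ × ℤ))) p)
    (fun s => Literature.Probability.Percolation.criticalProb
      (Literature.Probability.Percolation.dislocationLoopCover s)
      ((0 : Literature.Probability.LatticeModels.Site 3), ([] : List (ℤ × ℤ × ℤ))))
    (fun p n => (Literature.Probability.Percolation.bondPercolation
      (Literature.Probability.LatticeModels.zdGraph 3) p).real
      (Literature.Probability.Percolation.siteToBoundary 3 n))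
    (Literature.Probability.Percolation.criticalProbI 3)
    (fun s p => MeasureTheory.measureReal_nonneg)
    (fun s p hp => Literature.Probability.Percolation.theta_eq_zero_of_lt_criticalProb_holds
      (Literature.Probability.Percolation.dislocationLoopCover s)
      ((0 : Literature.Probability.LatticeModels.Site 3), ([] : List (ℤ × ℤ × ℤ))) p hp)
    h0 h1 h2 h3

/-- **Registered skeleton entry point** (D-0027 §3.3 shape `crux_of stub₁ … stubₖ`; the theorem
`ledger skeleton check` keys on): the crux BY NAME with no hypotheses — `CoverSlopeBound_of` applied to
the four declared stubs, used BY NAME. It contains no `sorry` of its own (`#print axioms` reaches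
`sorryAx` exactly through `stub_*`), so the file's sorry count equals the stub count. Naming note: the
registrar's `#h21_check_skeleton` takes the FIRST crux-concluding theorem in environment order and requires
its hypotheses to be registered obligations by name; `CoverSlopeBound_of` (hypotheses = the stub
statements as text, the BC3 shape) must therefore not be enumerated first — `CoverSlopeBound_of_stubs`
is (checked: environment order `…_of_stubs` < `…_of` < `…_proof`), which is why this entry point is not
called `CoverSlopeBound_proof`. [folklore] -/
theorem CoverSlopeBound_of_stubs :
    Summit.CriticalPhenomena.PercolationContinuityZ3.Theses.PercLoopDislocationCovers.CoverSlopeBound :=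
  CoverSlopeBound_of stub_coverCriticalDies stub_flatBall stub_shiftLowerBound stub_windowShape

end Summit.CriticalPhenomena.PercolationContinuityZ3.Cruxes.CoverSlopeBound.Birth
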